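import Summits.KontsevichZagierPeriods.Zeta5Search.Certificates.TwoTaleOmegaInduction

/-!
# ζ(2) two-tale line — rule domains of the Ω-induction for `a ≥ 17` (PROOF.md Lemma C2) (cell `pub-zeta5`, certifier `cert-2`)

HONEST FRAMING: systematic search; recurrence certificates; no irrationality claim unless certified.

fam-tele gen 3, `certs/tele/bmiss_general/PROOF.md` §5, LEMMA C2: for a target point `p ∈ Ω` with `a ≥ 17`, rule `δ` is APPLICABLE at
`p` when `p − kδ ∈ Ω` for `k ≤ 3` (`App δ`).  Kernel replay of the linear-arithmetic content: the inapplicability criteria for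
`g, b, e, f, a` (`not_app_*`), (1)+(2) the a-RULE DOMAIN — if `g` and `b` are inapplicable and `a` is applicable then the base point
`p − 3·(1,0,0,0,0)` has the orthant parametrisation of `TwoTaleTelescopeLeading.cA3_ne_zero` (`a_domain`), whence
`cA3_ne_zero_of_rules : c₃^a(p₀) ≠ 0` from rule data alone — and (3) the aef SHAPES — if `g, b, e, f, a` are all inapplicable then
`s = a−e`, `r = a−f` satisfy `max(s,r)+1 ≤ b ≤ min(s,r)+3`, `|s−r| ≤ 2`, `min(s,r) ≤ 2`, `g − a ∈ {1,2,3}` (the 81 shapes `(i,s,r,j)` of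
`fam_aef.json`, `i = b − max(s,r) − 1`, `j = g − a`) and rule `aef` IS applicable (`aef_shape`, `rule_exists`).  All proofs are `omega`
after unfolding; nothing analytic is involved.
-/

namespace Summit.KontsevichZagierPeriods.Zeta5Search.Certificates

namespace TwoTaleTelescope

/-- Rule `δ` is APPLICABLE at the target point `p`: the four points `p − kδ`, `k ≤ 3`, lie in `Ω` (PROOF.md §1; `k = 0` is `p ∈ Ω`). -/
def App (δ : Pt) : Set Pt := {p | ∀ k : ℕ, k ≤ 3 → p - (k : ℤ) • δ ∈ Omega}

/-- Base point / target point dictionary: `p ∈ App δ` iff `p − 3δ ∈ StepBase` for the trivial legitimacy predicate. -/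
theorem mem_App_iff_stepBase (δ : Pt) (hδ : δ ∈ dirs) (p : Pt) :
    p ∈ App δ ↔ p - (3 : ℤ) • δ ∈ StepBase (fun _ _ => True) δ := by
  simp only [App, StepBase, Set.mem_setOf_eq, hδ, true_and, and_true]
  constructor
  · intro h k hk
    have e : p - (3 : ℤ) • δ + (k : ℤ) • δ = p - ((3 - k : ℕ) : ℤ) • δ := by
      rw [Nat.cast_sub hk]; push_cast; rw [sub_smul]; abel
    rw [e]; exact h (3 - k) (by omega)
  · intro h k hk
    have e : p - (k : ℤ) • δ = p - (3 : ℤ) • δ + ((3 - k : ℕ) : ℤ) • δ := by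
      rw [Nat.cast_sub hk]; push_cast; rw [sub_smul]; abel
    rw [e]; exact h (3 - k) (by omega)

section criteria

/-! ### Componentwise evaluation of shifted points -/

/-- Components of `p − k·δ` for direction `g`. -/
theorem shift_G (p : Pt) (k : ℤ) :
    (p - k • dirG) 0 = p 0 ∧ (p - k • dirG) 1 = p 1 ∧ (p - k • dirG) 2 = p 2 ∧ (p - k • dirG) 3 = p 3 ∧ (p - k • dirG) 4 = p 4 - k := by
  simp [dirG, Pi.sub_apply]

/-- Components of `p − k·δ` for direction `b`. -/
theorem shift_B (p : Pt) (k : ℤ) :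
    (p - k • dirB) 0 = p 0 ∧ (p - k • dirB) 1 = p 1 - k ∧ (p - k • dirB) 2 = p 2 ∧ (p - k • dirB) 3 = p 3 ∧ (p - k • dirB) 4 = p 4 := by
  simp [dirB, Pi.sub_apply]

/-- Components of `p − k·δ` for direction `e`. -/
theorem shift_E (p : Pt) (k : ℤ) :
    (p - k • dirE) 0 = p 0 ∧ (p - k • dirE) 1 = p 1 ∧ (p - k • dirE) 2 = p 2 - k ∧ (p - k • dirE) 3 = p 3 ∧ (p - k • dirE) 4 = p 4 := by
  simp [dirE, Pi.sub_apply]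

/-- Components of `p − k·δ` for direction `f`. -/
theorem shift_F (p : Pt) (k : ℤ) :
    (p - k • dirF) 0 = p 0 ∧ (p - k • dirF) 1 = p 1 ∧ (p - k • dirF) 2 = p 2 ∧ (p - k • dirF) 3 = p 3 - k ∧ (p - k • dirF) 4 = p 4 := by
  simp [dirF, Pi.sub_apply]

/-- Components of `p − k·δ` for direction `a`. -/
theorem shift_A (p : Pt) (k : ℤ) :
    (p - k • dirA) 0 = p 0 - k ∧ (p - k • dirA) 1 = p 1 ∧ (p - k • dirA) 2 = p 2 ∧ (p - k • dirA) 3 = p 3 ∧ (p - k • dirA) 4 = p 4 := by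
  simp [dirA, Pi.sub_apply]

/-- Components of `p − k·δ` for direction `aef`. -/
theorem shift_AEF (p : Pt) (k : ℤ) :
    (p - k • dirAEF) 0 = p 0 - k ∧ (p - k • dirAEF) 1 = p 1 ∧ (p - k • dirAEF) 2 = p 2 - k ∧ (p - k • dirAEF) 3 = p 3 - k ∧
      (p - k • dirAEF) 4 = p 4 := by
  simp [dirAEF, Pi.sub_apply]

/-! ### Inapplicability criteria (PROOF.md Lemma C2, "elementary facts") -/

/-- Rule `g` inapplicable ⇒ `g ≤ a+3 ∨ g ≤ b+5`. -/
theorem not_app_G (p : Pt) (hp : p ∈ Omega) (h : p ∉ App dirG) : p 4 ≤ p 0 + 3 ∨ p 4 ≤ p 1 + 5 := by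
  simp only [App, Set.mem_setOf_eq, not_forall] at h
  obtain ⟨k, hk, hn⟩ := h
  rw [mem_Omega] at hp hn
  obtain ⟨e0, e1, e2, e3, e4⟩ := shift_G p k
  rw [e0, e1, e2, e3, e4] at hn
  have hk' : (k : ℤ) ≤ 3 := by exact_mod_cast hk
  omega

/-- Rule `b` inapplicable ⇒ `b ≤ 3 ∨ b+e ≤ a+3 ∨ b+f ≤ a+3 ∨ g ≥ 2e+2f+b−a−3`. -/
theorem not_app_B (p : Pt) (hp : p ∈ Omega) (h : p ∉ App dirB) :
    p 1 ≤ 3 ∨ p 1 + p 2 ≤ p 0 + 3 ∨ p 1 + p 3 ≤ p 0 + 3 ∨ 2 * p 2 + 2 * p 3 + p 1 - p 0 - 3 ≤ p 4 := by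
  simp only [App, Set.mem_setOf_eq, not_forall] at h
  obtain ⟨k, hk, hn⟩ := h
  rw [mem_Omega] at hp hn
  obtain ⟨e0, e1, e2, e3, e4⟩ := shift_B p k
  rw [e0, e1, e2, e3, e4] at hn
  have hk' : (k : ℤ) ≤ 3 := by exact_mod_cast hk
  omega

/-- Rule `e` inapplicable ⇒ `e ≤ 3 ∨ 2e ≤ a+6 ∨ (2e ≤ a+8 ∧ 2f ≤ a+2) ∨ b+e ≤ a+3 ∨ g ≥ 2e+2f+b−a−6`. -/
theorem not_app_E (p : Pt) (hp : p ∈ Omega) (h : p ∉ App dirE) :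
    p 2 ≤ 3 ∨ 2 * p 2 ≤ p 0 + 6 ∨ (2 * p 2 ≤ p 0 + 8 ∧ 2 * p 3 ≤ p 0 + 2) ∨ p 1 + p 2 ≤ p 0 + 3 ∨
      2 * p 2 + 2 * p 3 + p 1 - p 0 - 6 ≤ p 4 := by
  simp only [App, Set.mem_setOf_eq, not_forall] at h
  obtain ⟨k, hk, hn⟩ := h
  rw [mem_Omega] at hp hn
  obtain ⟨e0, e1, e2, e3, e4⟩ := shift_E p k
  rw [e0, e1, e2, e3, e4] at hn
  have hk' : (k : ℤ) ≤ 3 := by exact_mod_cast hk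
  omega

/-- Rule `f` inapplicable ⇒ `f ≤ 3 ∨ 2f ≤ a+6 ∨ (2f ≤ a+8 ∧ 2e ≤ a+2) ∨ b+f ≤ a+3 ∨ g ≥ 2e+2f+b−a−6`. -/
theorem not_app_F (p : Pt) (hp : p ∈ Omega) (h : p ∉ App dirF) :
    p 3 ≤ 3 ∨ 2 * p 3 ≤ p 0 + 6 ∨ (2 * p 3 ≤ p 0 + 8 ∧ 2 * p 2 ≤ p 0 + 2) ∨ p 1 + p 3 ≤ p 0 + 3 ∨
      2 * p 2 + 2 * p 3 + p 1 - p 0 - 6 ≤ p 4 := by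
  simp only [App, Set.mem_setOf_eq, not_forall] at h
  obtain ⟨k, hk, hn⟩ := h
  rw [mem_Omega] at hp hn
  obtain ⟨e0, e1, e2, e3, e4⟩ := shift_F p k
  rw [e0, e1, e2, e3, e4] at hn
  have hk' : (k : ℤ) ≤ 3 := by exact_mod_cast hk
  omega

/-- Rule `a` inapplicable (with `a ≥ 4`) ⇒ `max(e,f) ≥ a−2`. -/
theorem not_app_A (p : Pt) (hp : p ∈ Omega) (ha : 4 ≤ p 0) (h : p ∉ App dirA) : p 0 ≤ p 2 + 2 ∨ p 0 ≤ p 3 + 2 := by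
  simp only [App, Set.mem_setOf_eq, not_forall] at h
  obtain ⟨k, hk, hn⟩ := h
  rw [mem_Omega] at hp hn
  obtain ⟨e0, e1, e2, e3, e4⟩ := shift_A p k
  rw [e0, e1, e2, e3, e4] at hn
  have hk' : (k : ℤ) ≤ 3 := by exact_mod_cast hk
  omega

/-- Rule `a` applicable ⇒ `max(e,f) ≤ a−3`. -/
theorem app_A (p : Pt) (h : p ∈ App dirA) : p 2 ≤ p 0 - 3 ∧ p 3 ≤ p 0 - 3 := by
  have h3 := h 3 le_rfl
  rw [mem_Omega] at h3
  obtain ⟨e0, e1, e2, e3, e4⟩ := shift_A p ((3 : ℕ) : ℤ)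
  rw [e0, e1, e2, e3, e4] at h3
  push_cast at h3
  omega

end criteria

/-! ### Lemma C2 (1)+(2): the a-rule domain and `c₃^a ≠ 0` from rule data -/

/-- LEMMA C2 (1): for `a ≥ 17`, if rules `g` and `b` are inapplicable at `p ∈ Ω` then `b ≤ a − min(e,f) + 3` and `g ≤ a + 3`. -/
theorem gb_bounds (p : Pt) (hp : p ∈ Omega) (ha : 17 ≤ p 0) (hg : p ∉ App dirG) (hb : p ∉ App dirB) :
    (p 1 + p 2 ≤ p 0 + 3 ∨ p 1 + p 3 ≤ p 0 + 3) ∧ p 4 ≤ p 0 + 3 := by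
  have h1 := not_app_G p hp hg
  have h2 := not_app_B p hp hb
  rw [mem_Omega] at hp
  omega

/-- LEMMA C2 (2): on the a-rule domain (`a ≥ 17`, rules `g`, `b` inapplicable, rule `a` applicable) the BASE point `p₀ = p − 3·(1,0,0,0,0)`
has the orthant parametrisation of `TwoTaleTelescopeLeading.cA3_ne_zero`. -/
theorem a_domain (p : Pt) (hp : p ∈ Omega) (ha : 17 ≤ p 0) (hg : p ∉ App dirG) (hb : p ∉ App dirB) (hA : p ∈ App dirA) :
    ∃ β γ u w r : ℕ, β ≤ 2 ∧ γ ≤ 2 ∧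
      ((p 0 - 3 = 2 * r + 2 * w + 4 + u ∧ p 1 = r + w + 4 + β ∧ p 2 = r + w + 4 + u ∧ p 3 = r + 2 * w + 4 + u ∧
          p 4 = 2 * r + 2 * w + 8 + u + γ) ∨
       (p 0 - 3 = 2 * r + 2 * w + 4 + u ∧ p 1 = r + w + 4 + β ∧ p 3 = r + w + 4 + u ∧ p 2 = r + 2 * w + 4 + u ∧
          p 4 = 2 * r + 2 * w + 8 + u + γ)) := by
  obtain ⟨hb', hg'⟩ := gb_bounds p hp ha hg hb
  obtain ⟨he3, hf3⟩ := app_A p hA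
  rw [mem_Omega] at hp
  obtain ⟨-, -, -, -, -, h5, h6, -, -, -, h10, h11, h12, -, -⟩ := hp
  rcases le_total (p 2) (p 3) with hef | hfe
  · -- `e ≤ f`: S = a₀ − e = r + w, R = a₀ − f = r
    obtain ⟨r, hr⟩ := Int.eq_ofNat_of_zero_le (show (0 : ℤ) ≤ p 0 - 3 - p 3 by omega)
    obtain ⟨w, hw⟩ := Int.eq_ofNat_of_zero_le (show (0 : ℤ) ≤ p 3 - p 2 by omega)
    obtain ⟨u, hu⟩ := Int.eq_ofNat_of_zero_le (show (0 : ℤ) ≤ 2 * p 2 - p 0 - 1 by omega)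
    obtain ⟨β, hβ⟩ := Int.eq_ofNat_of_zero_le (show (0 : ℤ) ≤ p 1 + p 2 - p 0 - 1 by omega)
    obtain ⟨γ, hγ⟩ := Int.eq_ofNat_of_zero_le (show (0 : ℤ) ≤ p 4 - p 0 - 1 by omega)
    exact ⟨β, γ, u, w, r, by omega, by omega, Or.inl ⟨by omega, by omega, by omega, by omega, by omega⟩⟩
  · -- `f ≤ e`: the mirror case
    obtain ⟨r, hr⟩ := Int.eq_ofNat_of_zero_le (show (0 : ℤ) ≤ p 0 - 3 - p 2 by omega)
    obtain ⟨w, hw⟩ := Int.eq_ofNat_of_zero_le (show (0 : ℤ) ≤ p 2 - p 3 by omega)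
    obtain ⟨u, hu⟩ := Int.eq_ofNat_of_zero_le (show (0 : ℤ) ≤ 2 * p 3 - p 0 - 1 by omega)
    obtain ⟨β, hβ⟩ := Int.eq_ofNat_of_zero_le (show (0 : ℤ) ≤ p 1 + p 3 - p 0 - 1 by omega)
    obtain ⟨γ, hγ⟩ := Int.eq_ofNat_of_zero_le (show (0 : ℤ) ≤ p 4 - p 0 - 1 by omega)
    exact ⟨β, γ, u, w, r, by omega, by omega, Or.inr ⟨by omega, by omega, by omega, by omega, by omega⟩⟩

/-- **(S3) for direction `a` from rule data** (PROOF.md §3 + Lemma C2): if `a ≥ 17`, rules `g`, `b` are inapplicable at the target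
`p ∈ Ω` and rule `a` is applicable, then `c₃^a(p₀) ≠ 0` at the base point `p₀ = p − 3·(1,0,0,0,0)`. -/
theorem cA3_ne_zero_of_rules (p : Pt) (hp : p ∈ Omega) (ha : 17 ≤ p 0) (hg : p ∉ App dirG) (hb : p ∉ App dirB)
    (hA : p ∈ App dirA) : spvalC cA3 (p 0 - 3) (p 1) (p 2) (p 3) (p 4) ≠ 0 := by
  have hdom := a_domain p hp ha hg hb hA
  have hp' := hp
  rw [mem_Omega] at hp'
  obtain ⟨-, -, -, -, -, h5, h6, -, -, -, h10, h11, -, -, -⟩ := hp'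
  exact cA3_ne_zero _ _ _ _ _ (by omega) (by omega) (by omega) (by omega) (by omega) hdom

/-! ### Lemma C2 (3): the aef shapes and rule completeness for `a ≥ 17` -/

/-- LEMMA C2 (3), shape part: for `a ≥ 17`, if rules `g, b, e, f, a` are all inapplicable at `p ∈ Ω` then, with `s = a − e`, `r = a − f`:
`0 ≤ s, r`, `max(s,r)+1 ≤ b ≤ min(s,r)+3`, `|s − r| ≤ 2`, `min(s,r) ≤ 2` and `g − a ∈ {1,2,3}` — the 81 shapes of `fam_aef.json`. -/
theorem aef_shape (p : Pt) (hp : p ∈ Omega) (ha : 17 ≤ p 0) (hg : p ∉ App dirG) (hb : p ∉ App dirB) (he : p ∉ App dirE)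
    (hf : p ∉ App dirF) (hA : p ∉ App dirA) :
    0 ≤ p 0 - p 2 ∧ 0 ≤ p 0 - p 3 ∧ p 0 - p 2 + 1 ≤ p 1 ∧ p 0 - p 3 + 1 ≤ p 1 ∧ p 1 ≤ p 0 - p 2 + 3 ∧ p 1 ≤ p 0 - p 3 + 3 ∧
      (p 0 - p 2 ≤ 2 ∨ p 0 - p 3 ≤ 2) ∧ p 0 + 1 ≤ p 4 ∧ p 4 ≤ p 0 + 3 := by
  obtain ⟨hb', hg'⟩ := gb_bounds p hp ha hg hb
  have hE := not_app_E p hp he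
  have hF := not_app_F p hp hf
  have hA' := not_app_A p hp (by omega) hA
  rw [mem_Omega] at hp
  omega

/-- LEMMA C2 (3), applicability part: under the same hypotheses rule `aef` IS applicable at `p`. -/
theorem app_AEF_of_shape (p : Pt) (hp : p ∈ Omega) (ha : 17 ≤ p 0) (hg : p ∉ App dirG) (hb : p ∉ App dirB) (he : p ∉ App dirE)
    (hf : p ∉ App dirF) (hA : p ∉ App dirA) : p ∈ App dirAEF := by
  have hs := aef_shape p hp ha hg hb he hf hA
  rw [mem_Omega] at hp
  intro k hk
  rw [mem_Omega]
  obtain ⟨e0, e1, e2, e3, e4⟩ := shift_AEF p k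
  rw [e0, e1, e2, e3, e4]
  have hk' : (k : ℤ) ≤ 3 := by exact_mod_cast hk
  have hk0 : (0 : ℤ) ≤ k := by exact_mod_cast Nat.zero_le k
  omega

/-- **Rule completeness for `a ≥ 17`** (PROOF.md Lemma C2, consequence): every `p ∈ Ω` with `a ≥ 17` admits one of the rules
`g, b, e, f, a, aef`; hence the BASE of the Ω-induction lies in `{a ≤ 16}` as far as applicability is concerned. -/
theorem rule_exists (p : Pt) (hp : p ∈ Omega) (ha : 17 ≤ p 0) :
    p ∈ App dirG ∨ p ∈ App dirB ∨ p ∈ App dirE ∨ p ∈ App dirF ∨ p ∈ App dirA ∨ p ∈ App dirAEF := by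
  by_cases hg : p ∈ App dirG; · exact Or.inl hg
  by_cases hb : p ∈ App dirB; · exact Or.inr (Or.inl hb)
  by_cases he : p ∈ App dirE; · exact Or.inr (Or.inr (Or.inl he))
  by_cases hf : p ∈ App dirF; · exact Or.inr (Or.inr (Or.inr (Or.inl hf)))
  by_cases hA : p ∈ App dirA; · exact Or.inr (Or.inr (Or.inr (Or.inr (Or.inl hA))))
  exact Or.inr (Or.inr (Or.inr (Or.inr (Or.inr (app_AEF_of_shape p hp ha hg hb he hf hA)))))

end TwoTaleTelescope

end Summit.KontsevichZagierPeriods.Zeta5Search.Certificates
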